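import Summits.QuantumFields.YangMills.Theorems.BalabanUVNodesN22W1RelCentredSector
import Literature.MathematicalPhysics.QuantumFieldTheory.Balaban1983to89.B13Term214WindowDilated

/-!
# BalabanUVNodes ∕ node N22 = NE9 — THE W1 OBJECT ON THE RELATIVE-DISC CENTRED ROAD (RE-TYPING M1′), MODULE J1: THE JUNCTION «WINDOW-DILATED MEMBERS ⇒ SECTOR CLAUSES» —
# from a producer's per-base-point statements in the dilation parameter `b = t∕u` on the ball `|b − 1| < ρ_b` (dag-n10-c g6 `B13Term214WindowDilated`, `B13Term214Centred`,
# `B13Bound226Centred`) to the consumer's clauses on the RELATIVE SECTOR `{u | ∃ t ∈ ]0,γ], dist u t < c·t}` of the leaf of record R2c (`hlast`, `hprop`, (P), (S-vertex-T′), `hagree`)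

Cell `pub-ymgap`, HUMAN RULING D-0062 (Track A), R134 ACCELERATION re-seat `pub-ymgap-dag-n22-c` (strategy s1), generation 7, file J1.  THEOREMS ONLY; imports R3
`…N22W1RelCentredSector` (the sector, `differentiableOn_relSector_of_closedBalls`) and dag-n10-c g6's `B13Term214WindowDilated` §3 (`closedBall_subset_window`,
`differentiableOn_comp_window`) BY NAME.  `--supports` K3⁵ `SpineGivenEndpointR13SepCoP` (stmt-QuantumFields-20296; plan g68 KEY-20, dag-lead WORDS-141) as a helper.

WHY.  The s1 leaf of record R2c (`…N22W1RelCentredTermDatum214Generated`, `hdata` ll. 105–142) displays, for ONE continued term-functional family `TFc` of the complex LAST coupling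
`u` and a coupling-BLIND centre `V`, four analytic clauses on a domain family `D k′` containing the window `]0, γ]` and the relative closed discs `closedBall (t:ℂ)(cA·t)`: (S-last-T′)
holomorphy + the (2.26) weight bound on `D k′`; (S-226-T′) holomorphy + bound in the OLDER terms at each fixed `u ∈ D k′`; (P) the same for `V`; (S-vertex-T′) the centred letter
`‖TFc u − V‖ ≤ Mv·‖u‖²·(weight·e^{a₅|Z|})`; and the real-window agreement `hagree`.  The producer (node N10's lane, dag-n10-c g6, lens T20∕T21) works in the WINDOW-DILATED picture:
at a base point `t ∈ ]0, γ]` the (2.14) term is continued in the dilation parameter `b` (`b²A(σ)`, `bΓ(σ)`, `b²W + O`), every statement is made for `b ∈ ball 1 ρ_b`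
(`h226_torus_windowDilated_of_primitives`, `differentiableOn_term214_torus_windowDilated(_history)_of_primitives`, `h226_torus_windowDilated_centred_of_primitives` with the
factor `t²`), the members at two base points see the same coupling through the REAL ratio (`term214_windowDilated_basePoint`), and the member at `b = 1` is the keyed display
(`term214_eq_windowDilated_of_dilationCovariant`).  THIS FILE is the consumer-side junction, typed ONCE over ABSTRACT members `m : ℝ → ℂ → ℂ` (base point, dilation parameter),
so that the producer's output at the datum of record becomes an `exact` into R2c: the coupling `u` of the relative ball `dist u t < c·t` is read at `b = t∕u ∈ ball 1 ρ_b` as soon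
as `c∕(1 − c) < ρ_b` (n10-c §3), and `(1 − c)·t ≤ ‖u‖` there turns the producer's `t²` into the consumer's `‖u‖²` at the price `Mv = (1 − c)⁻²` (γ-free).

WHAT.  §1 geometry of the relative ball (`(1 − c)t ≤ ‖u‖`, `t² ≤ (1−c)⁻²‖u‖²`, `u ≠ 0`, `t∕u ∈ ball 1 ρ_b`).  §2 a function `f` READ FROM THE MEMBERS on the relative balls
(`f u = m t (t∕u)` whenever `dist u t < c·t`): holomorphy on the sector (`differentiableOn_relSector_of_members`), the bound (`norm_le_relSector_of_members`), ★ the centred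
letter in R2c's shape (`norm_sub_le_sq_relSector_of_members`: `‖f u − V‖ ≤ ((1−c)⁻²·Mv)·‖u‖²·W` from `‖m t b − V‖ ≤ Mv·t²·W` on the balls), the window reading
(`eq_on_window_of_members`: `f s = m s 1`), and the fixed-coupling transport of a parametrised statement (`param_relSector_of_members`: (S-226-T′)∕(P) at `u` from the same
statement at the member `(t, t∕u)`).  §3 the canonical reading from BASE-POINT-FREE members (`read_of_basePointFree`: `m s₀ (s₀∕u) = m t (t∕u)`), and ★ `relSector_clauses_of_members`
= the four clauses at once for `f := fun u ↦ m s₀ (s₀∕u)`.  §4 the two-step centre (`centred_of_twoStep`): a producer's centred bound about a `b`-DEPENDENT reference member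
`‖m t b − ctr t b‖ ≤ M₁t²W` (the centred (2.15), n10-c `B13Bound226Centred`) plus the reference's own approach to a coupling-blind value `‖ctr t b − V‖ ≤ M₂t²W` (the
large-field tail of the frozen-potential term, lens T22∕rider P⁗ §18.5) give the clause about `V` with `M₁ + M₂` — the shape R2c consumes (its `V` has no coupling argument).

HONEST FRAMING.  Elementary: plane geometry of the relative balls + congruence along `u ↦ t∕u`; count-neutral; nothing of Bałaban's asserted; no producer statement is proved
here (the members, their bounds, the base-point freeness and the dilation covariance of the datum are HYPOTHESES — dag-n10-c's theorems supply them in B13 currency for the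
window-dilated (2.14) family, the identification with the datum of record `(𝔇 k′).TF` is def-W1∕N09's displayed law); (S-vertex-T′) itself is NOT PRINTED ([I] (2.13) p. 268
records only the first-order vanishing of the potential at `g_k = 0`).  0 `sorry`, 0 `def`, standard axioms.

References (TYPES only): [I] = [Balaban1987RG1] §1 p. 263 (the window; «C^∞ (or analytic)» in the last coupling), (2.9)–(2.13) pp. 266–268 (`B = g_kB′`); [II] =
[Balaban1988RG2Cluster] (2.14)–(2.15) p. 15, (2.26) p. 17.
-/

noncomputable section

namespace YMDAG.N22.W1

open Set Metric
open Literature.MathematicalPhysics.QuantumFieldTheory.Balaban1983to89.B13Term214WindowDilated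
  (closedBall_subset_window differentiableOn_comp_window)

/-! ## §1 Geometry of the relative ball `dist u t < c·t` -/

/-- **ON THE RELATIVE BALL THE COUPLING IS BOUNDED BELOW BY THE BASE POINT**: `dist u t < c·t`, `t > 0` ⇒ `(1 − c)·t ≤ ‖u‖`. [folklore] -/
theorem norm_ge_of_dist_lt_rel {u : ℂ} {t c : ℝ} (ht : 0 < t) (h : dist u (t : ℂ) < c * t) : (1 - c) * t ≤ ‖u‖ := by
  have h1 : ‖(t : ℂ)‖ - ‖u‖ ≤ ‖(t : ℂ) - u‖ := norm_sub_norm_le _ _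
  rw [norm_sub_rev, Complex.norm_real, Real.norm_of_nonneg ht.le, ← dist_eq_norm] at h1
  linarith

/-- **THE PRODUCER's `t²` AGAINST THE CONSUMER's `‖u‖²`**: on the relative ball of aperture `c < 1`, `t² ≤ (1 − c)⁻²·‖u‖²` — the conversion factor `Mv = (1−c)⁻²` of the
centred letter, free of `γ`. [folklore] -/
theorem sq_le_of_dist_lt_rel {u : ℂ} {t c : ℝ} (ht : 0 < t) (hc1 : c < 1) (h : dist u (t : ℂ) < c * t) : t ^ 2 ≤ (1 - c)⁻¹ ^ 2 * ‖u‖ ^ 2 := by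
  have h1 := norm_ge_of_dist_lt_rel ht h
  have h1c : 0 < 1 - c := sub_pos.2 hc1
  have h2 : t ≤ (1 - c)⁻¹ * ‖u‖ := by
    rw [le_inv_mul_iff₀ h1c]
    exact h1
  calc t ^ 2 ≤ ((1 - c)⁻¹ * ‖u‖) ^ 2 := pow_le_pow_left₀ ht.le h2 2
    _ = (1 - c)⁻¹ ^ 2 * ‖u‖ ^ 2 := by ring

/-- **NO POINT OF A RELATIVE BALL OF APERTURE `c < 1` IS ZERO COUPLING.** [folklore] -/
theorem ne_zero_of_dist_lt_rel {u : ℂ} {t c : ℝ} (ht : 0 < t) (hc1 : c < 1) (h : dist u (t : ℂ) < c * t) : u ≠ 0 := fun h0 => by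
  have h1 := norm_ge_of_dist_lt_rel ht h
  rw [h0, norm_zero] at h1
  nlinarith [sub_pos.2 hc1]

/-- **THE DILATION PARAMETER OF A COUPLING OF THE RELATIVE BALL LIES IN THE PRODUCER's BALL**: `dist u t < c·t`, `0 ≤ c < 1`, `c∕(1−c) < ρ_b` ⇒ `t∕u ∈ ball 1 ρ_b`
(dag-n10-c g6 `closedBall_subset_window`, read on the open ball). [folklore] [cite: Balaban1987RG1, (2.10) p.267] -/
theorem div_mem_ball_of_dist_lt_rel {u : ℂ} {t c ρb : ℝ} (ht : 0 < t) (hc0 : 0 ≤ c) (hc1 : c < 1) (hρb : c / (1 - c) < ρb) (h : dist u (t : ℂ) < c * t) :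
    (t : ℂ) / u ∈ ball (1 : ℂ) ρb :=
  (closedBall_subset_window ht hc0 hc1 hρb (mem_closedBall.2 h.le)).2

/-- The producer's ball has positive radius as soon as the aperture is positive (`0 < c < 1`, `c∕(1−c) < ρ_b` ⇒ `0 < ρ_b`), so `b = 1` is a member. [folklore] -/
theorem radius_pos_of_aperture {c ρb : ℝ} (hc0 : 0 < c) (hc1 : c < 1) (hρb : c / (1 - c) < ρb) : 0 < ρb :=
  lt_trans (div_pos hc0 (sub_pos.2 hc1)) hρb

/-! ## §2 A function read from the members on the relative balls: the four clauses of R2c on the sector -/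

/-- **(S-last-T′), HOLOMORPHY HALF, ON THE SECTOR FROM THE MEMBERS**: if every member `m t`, `t ∈ ]0,γ]`, is holomorphic on `ball 1 ρ_b` and `f` is read from the members on
the relative balls (`f u = m t (t∕u)` for `dist u t < c·t`), `0 ≤ c < 1`, `c∕(1−c) < ρ_b`, then `f` is holomorphic on the sector `{u | ∃ t ∈ ]0,γ], dist u t < c·t}` — every point
of the sector is interior to a relative ball on which `f` is the composite `u ↦ m t (t∕u)` (dag-n10-c g6 `differentiableOn_comp_window`).
[cite: Balaban1987RG1, §1 p.263 ("C^∞ (or analytic)") and (2.10) p.267] -/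
theorem differentiableOn_relSector_of_members {γ c ρb : ℝ} (hc0 : 0 ≤ c) (hc1 : c < 1) (hρb : c / (1 - c) < ρb) {m : ℝ → ℂ → ℂ} {f : ℂ → ℂ}
    (hdiff : ∀ t ∈ Ioc (0 : ℝ) γ, DifferentiableOn ℂ (m t) (ball (1 : ℂ) ρb))
    (hread : ∀ t ∈ Ioc (0 : ℝ) γ, ∀ u : ℂ, dist u (t : ℂ) < c * t → f u = m t ((t : ℂ) / u)) :
    DifferentiableOn ℂ f {z : ℂ | ∃ t ∈ Ioc (0 : ℝ) γ, dist z (t : ℂ) < c * t} := fun z hz => by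
  obtain ⟨t, ht, hd⟩ := hz
  -- the composite is holomorphic on the window set, which contains the closed relative disc, a neighbourhood of `z`
  have hW : DifferentiableOn ℂ (fun u => m t ((t : ℂ) / u)) (closedBall (t : ℂ) (c * t)) :=
    (differentiableOn_comp_window (hdiff t ht) t).mono (closedBall_subset_window ht.1 hc0 hc1 hρb)
  have hn : ball (t : ℂ) (c * t) ∈ nhds z := isOpen_ball.mem_nhds (mem_ball.2 hd)
  have hAt : DifferentiableAt ℂ (fun u => m t ((t : ℂ) / u)) z :=
    hW.differentiableAt (Filter.mem_of_superset hn ball_subset_closedBall)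
  have heq : f =ᶠ[nhds z] fun u => m t ((t : ℂ) / u) :=
    Filter.eventually_of_mem hn fun u hu => hread t ht u (mem_ball.1 hu)
  exact (hAt.congr_of_eventuallyEq heq).differentiableWithinAt

/-- **(S-last-T′), WEIGHT HALF, ON THE SECTOR FROM THE MEMBERS**: a bound `‖m t b‖ ≤ W` for every member on `ball 1 ρ_b` is the bound `‖f u‖ ≤ W` on the sector.
[cite: Balaban1988RG2Cluster, (2.26) p.17; Balaban1987RG1, (2.10) p.267] -/
theorem norm_le_relSector_of_members {γ c ρb : ℝ} (hc0 : 0 ≤ c) (hc1 : c < 1) (hρb : c / (1 - c) < ρb) {m : ℝ → ℂ → ℂ} {f : ℂ → ℂ} {W : ℝ}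
    (hbd : ∀ t ∈ Ioc (0 : ℝ) γ, ∀ b ∈ ball (1 : ℂ) ρb, ‖m t b‖ ≤ W)
    (hread : ∀ t ∈ Ioc (0 : ℝ) γ, ∀ u : ℂ, dist u (t : ℂ) < c * t → f u = m t ((t : ℂ) / u)) :
    ∀ z ∈ {z : ℂ | ∃ t ∈ Ioc (0 : ℝ) γ, dist z (t : ℂ) < c * t}, ‖f z‖ ≤ W := fun z hz => by
  obtain ⟨t, ht, hd⟩ := hz
  rw [hread t ht z hd]
  exact hbd t ht _ (div_mem_ball_of_dist_lt_rel ht.1 hc0 hc1 hρb hd)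

/-- **★ (S-vertex-T′) ON THE SECTOR FROM THE MEMBERS' CENTRED BOUND — IN R2c's SHAPE.**  If every member obeys the producer's centred bound `‖m t b − V‖ ≤ Mv·t²·W` about ONE
coupling-blind value `V` on `ball 1 ρ_b` (the window-dilated centred (2.26), factor `t²` = the base point squared), then the function read from the members obeys
`‖f u − V‖ ≤ ((1−c)⁻²·Mv)·‖u‖²·W` on the sector of aperture `c` (`0 < c < 1`, `c∕(1−c) < ρ_b`): the coupling of the relative ball dominates its base point, `(1−c)t ≤ ‖u‖`.
This is the consumer's `hcen`∕(S-vertex-T′) clause of R2 ∕ R2b ∕ R2c with `Mv ↦ (1−c)⁻²·Mv`, free of `γ`.  (Non-negativity of `Mv·W` is read off the hypothesis at `b = 1`.)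
NOT PRINTED as an estimate: [I] (2.13) p. 268 records the vanishing of the potential at `g_k = 0`; the second-order letter is the producer's centred (2.15) (lens T21).
[cite: Balaban1987RG1, (2.12)-(2.13) p.268 and (2.10) p.267; Balaban1988RG2Cluster, (2.14)-(2.15) p.15 and (2.26) p.17] -/
theorem norm_sub_le_sq_relSector_of_members {γ c ρb : ℝ} (hc0 : 0 < c) (hc1 : c < 1) (hρb : c / (1 - c) < ρb) {m : ℝ → ℂ → ℂ} {f : ℂ → ℂ} {V : ℂ} {Mv W : ℝ}
    (hcen : ∀ t ∈ Ioc (0 : ℝ) γ, ∀ b ∈ ball (1 : ℂ) ρb, ‖m t b - V‖ ≤ Mv * t ^ 2 * W)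
    (hread : ∀ t ∈ Ioc (0 : ℝ) γ, ∀ u : ℂ, dist u (t : ℂ) < c * t → f u = m t ((t : ℂ) / u)) :
    ∀ z ∈ {z : ℂ | ∃ t ∈ Ioc (0 : ℝ) γ, dist z (t : ℂ) < c * t}, ‖f z - V‖ ≤ (1 - c)⁻¹ ^ 2 * Mv * ‖z‖ ^ 2 * W := fun z hz => by
  obtain ⟨t, ht, hd⟩ := hz
  -- the sign of `Mv·W`, from the member `b = 1`
  have h1 : (1 : ℂ) ∈ ball (1 : ℂ) ρb := mem_ball_self (radius_pos_of_aperture hc0 hc1 hρb)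
  have hMW : 0 ≤ Mv * W := by
    have h0 : 0 ≤ Mv * t ^ 2 * W := (norm_nonneg _).trans (hcen t ht 1 h1)
    have ht2 : 0 < t ^ 2 := pow_pos ht.1 2
    by_contra hneg
    have : Mv * t ^ 2 * W < 0 := by
      have : Mv * W < 0 := lt_of_not_ge hneg
      nlinarith
    linarith
  rw [hread t ht z hd]
  calc ‖m t ((t : ℂ) / z) - V‖ ≤ Mv * t ^ 2 * W := hcen t ht _ (div_mem_ball_of_dist_lt_rel ht.1 hc0.le hc1 hρb hd)
    _ = t ^ 2 * (Mv * W) := by ring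
    _ ≤ ((1 - c)⁻¹ ^ 2 * ‖z‖ ^ 2) * (Mv * W) := mul_le_mul_of_nonneg_right (sq_le_of_dist_lt_rel ht.1 hc1 hd) hMW
    _ = (1 - c)⁻¹ ^ 2 * Mv * ‖z‖ ^ 2 * W := by ring

/-- **THE REAL-WINDOW READING**: a function read from the members takes at the window point `s ∈ ]0,γ]` the value of the member of base point `s` at `b = 1` (`dist s s = 0 < c·s`,
`s∕s = 1`) — the consumer's `hagree` once the producer identifies `m s 1` with the keyed display at coupling `s` (dag-n10-c g6 `term214_eq_windowDilated_of_dilationCovariant` at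
`r = 1`, i.e. the datum's display itself). [cite: Balaban1987RG1, §1 p.263 (the window) and (2.9)-(2.12) pp.266-267] -/
theorem eq_on_window_of_members {γ c : ℝ} (hc0 : 0 < c) {m : ℝ → ℂ → ℂ} {f : ℂ → ℂ}
    (hread : ∀ t ∈ Ioc (0 : ℝ) γ, ∀ u : ℂ, dist u (t : ℂ) < c * t → f u = m t ((t : ℂ) / u)) :
    ∀ s ∈ Ioc (0 : ℝ) γ, f (s : ℂ) = m s 1 := fun s hs => by
  have hne : (s : ℂ) ≠ 0 := Complex.ofReal_ne_zero.2 hs.1.ne'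
  rw [hread s hs (s : ℂ) (by rw [dist_self]; exact mul_pos hc0 hs.1), div_self hne]

/-- **THE FIXED-COUPLING TRANSPORT OF A PARAMETRISED STATEMENT — (S-226-T′) ∕ (P) on the sector from the same statement at the members.**  Members and the read function
may carry a parameter `p` (the OLDER TERMS of (2.14), entering through the potentials, [II] (1.41)); if for every base point `t` and every `b ∈ ball 1 ρ_b` the map
`z ↦ m (cv z) t b` along a parameter curve `cv` is holomorphic on an open set `O` with the bound `W` there (dag-n10-c g6
`differentiableOn_term214_torus_windowDilated_history_of_primitives` + `h226_torus_windowDilated_of_primitives` at the fixed member), then at every coupling `u` of the sector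
`z ↦ f (cv z) u` is holomorphic on `O` with the same bound — the member `(t, t∕u)` of the relative ball through `u` serves.
[cite: Balaban1988RG2Cluster, (1.41) p.11, (2.14) p.15 and (2.26) p.17; Balaban1987RG1, (2.12)-(2.13) p.268] -/
theorem param_relSector_of_members {Par : Type*} {γ c ρb : ℝ} (hc0 : 0 ≤ c) (hc1 : c < 1) (hρb : c / (1 - c) < ρb) {m : Par → ℝ → ℂ → ℂ} {f : Par → ℂ → ℂ}
    (hread : ∀ p, ∀ t ∈ Ioc (0 : ℝ) γ, ∀ u : ℂ, dist u (t : ℂ) < c * t → f p u = m p t ((t : ℂ) / u))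
    {O : Set ℂ} {cv : ℂ → Par} {W : ℝ}
    (h : ∀ t ∈ Ioc (0 : ℝ) γ, ∀ b ∈ ball (1 : ℂ) ρb, DifferentiableOn ℂ (fun z => m (cv z) t b) O ∧ ∀ z ∈ O, ‖m (cv z) t b‖ ≤ W) :
    ∀ u ∈ {z : ℂ | ∃ t ∈ Ioc (0 : ℝ) γ, dist z (t : ℂ) < c * t}, DifferentiableOn ℂ (fun z => f (cv z) u) O ∧ ∀ z ∈ O, ‖f (cv z) u‖ ≤ W := fun u hu => by
  obtain ⟨t, ht, hd⟩ := hu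
  have hb := div_mem_ball_of_dist_lt_rel ht.1 hc0 hc1 hρb hd
  have hfun : (fun z => f (cv z) u) = fun z => m (cv z) t ((t : ℂ) / u) := funext fun z => hread (cv z) t ht u hd
  refine ⟨hfun ▸ (h t ht _ hb).1, fun z hz => ?_⟩
  rw [hread (cv z) t ht u hd]
  exact (h t ht _ hb).2 z hz

/-! ## §3 The canonical reading from base-point-free members, and the four clauses at once -/

/-- **BASE-POINT FREENESS MAKES THE READING CANONICAL**: if the members at two base points see the same coupling through the REAL ratio — `m s₁ ((s₁∕s₀)·b) = m s₀ b` for all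
`s₀, s₁ ∈ ]0,γ]` and every complex `b` (dag-n10-c g6 `term214_windowDilated_basePoint` under the dilation covariance of the last-line data) — then `m s₀ (s₀∕u) = m t (t∕u)` for
all base points `s₀, t` and EVERY complex `u` (at `u = 0` both sides are the members at `b = 0`, Lean's `x ∕ 0 = 0`; the sector never meets `u = 0`).  So ONE function
`u ↦ m s₀ (s₀∕u)` is read from the members on every relative ball. [cite: Balaban1987RG1, (2.9)-(2.12) pp.266-267; Balaban1988RG2Cluster, (2.14) p.15] -/
theorem read_of_basePointFree {γ : ℝ} {m : ℝ → ℂ → ℂ}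
    (hbase : ∀ s₀ ∈ Ioc (0 : ℝ) γ, ∀ s₁ ∈ Ioc (0 : ℝ) γ, ∀ b : ℂ, m s₁ ((((s₁ / s₀ : ℝ)) : ℂ) * b) = m s₀ b) :
    ∀ s₀ ∈ Ioc (0 : ℝ) γ, ∀ t ∈ Ioc (0 : ℝ) γ, ∀ u : ℂ, m s₀ ((s₀ : ℂ) / u) = m t ((t : ℂ) / u) := fun s₀ hs₀ t ht u => by
  have htne : (t : ℂ) ≠ 0 := Complex.ofReal_ne_zero.2 ht.1.ne'
  have h := hbase t ht s₀ hs₀ ((t : ℂ) / u)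
  have e : (((s₀ / t : ℝ)) : ℂ) * ((t : ℂ) / u) = (s₀ : ℂ) / u := by
    rw [Complex.ofReal_div, div_mul_div_comm, mul_comm (t : ℂ) u, mul_div_mul_right _ _ htne]
  rw [e] at h
  exact h

/-- **★ THE FOUR CLAUSES OF R2c ON THE SECTOR, AT ONCE, FOR THE CANONICAL CONTINUATION `f := fun u ↦ m s₀ (s₀∕u)` OF BASE-POINT-FREE MEMBERS** (`0 < c < 1`, `c∕(1−c) < ρ_b`,
any base point `s₀ ∈ ]0,γ]`): from the producer's per-base-point statements on `ball 1 ρ_b` — holomorphy, the bound `W`, the centred bound `Mv·t²·W` about a coupling-blind `V`,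
base-point freeness — the consumer gets on the sector `S = {u | ∃ t ∈ ]0,γ], dist u t < c·t}`: `f` holomorphic on `S`; `‖f u‖ ≤ W` on `S`; `‖f u − V‖ ≤ ((1−c)⁻²·Mv)·‖u‖²·W` on `S`;
`f s = m s 1` on the window.  With R3 `relSector_domainClauses` (domain family `D := fun _ ↦ S`, displayed discs of any aperture `cA < c`) these are EXACTLY the `hlast` ∕ `hcen` ∕
`hagree`-shape conjuncts of R2's engine for one `(k′, Z, t, old, φ)`-slice (`W := weight·e^{a₅|Z|}`); `param_relSector_of_members` gives `hprop` ∕ `hpropV` the same way.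
[cite: Balaban1987RG1, §1 p.263, (2.9)-(2.13) pp.266-268; Balaban1988RG2Cluster, (2.14)-(2.15) p.15 and (2.26) p.17] -/
theorem relSector_clauses_of_members {γ c ρb : ℝ} (hc0 : 0 < c) (hc1 : c < 1) (hρb : c / (1 - c) < ρb) {m : ℝ → ℂ → ℂ} {V : ℂ} {Mv W : ℝ} {s₀ : ℝ}
    (hs₀ : s₀ ∈ Ioc (0 : ℝ) γ)
    (hbase : ∀ s₀ ∈ Ioc (0 : ℝ) γ, ∀ s₁ ∈ Ioc (0 : ℝ) γ, ∀ b : ℂ, m s₁ ((((s₁ / s₀ : ℝ)) : ℂ) * b) = m s₀ b)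
    (hdiff : ∀ t ∈ Ioc (0 : ℝ) γ, DifferentiableOn ℂ (m t) (ball (1 : ℂ) ρb))
    (hbd : ∀ t ∈ Ioc (0 : ℝ) γ, ∀ b ∈ ball (1 : ℂ) ρb, ‖m t b‖ ≤ W)
    (hcen : ∀ t ∈ Ioc (0 : ℝ) γ, ∀ b ∈ ball (1 : ℂ) ρb, ‖m t b - V‖ ≤ Mv * t ^ 2 * W) :
    DifferentiableOn ℂ (fun u => m s₀ ((s₀ : ℂ) / u)) {z : ℂ | ∃ t ∈ Ioc (0 : ℝ) γ, dist z (t : ℂ) < c * t} ∧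
    (∀ z ∈ {z : ℂ | ∃ t ∈ Ioc (0 : ℝ) γ, dist z (t : ℂ) < c * t}, ‖m s₀ ((s₀ : ℂ) / z)‖ ≤ W) ∧
    (∀ z ∈ {z : ℂ | ∃ t ∈ Ioc (0 : ℝ) γ, dist z (t : ℂ) < c * t}, ‖m s₀ ((s₀ : ℂ) / z) - V‖ ≤ (1 - c)⁻¹ ^ 2 * Mv * ‖z‖ ^ 2 * W) ∧
    (∀ s ∈ Ioc (0 : ℝ) γ, m s₀ ((s₀ : ℂ) / (s : ℂ)) = m s 1) := by
  have hread : ∀ t ∈ Ioc (0 : ℝ) γ, ∀ u : ℂ, dist u (t : ℂ) < c * t → m s₀ ((s₀ : ℂ) / u) = m t ((t : ℂ) / u) :=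
    fun t ht u _ => read_of_basePointFree hbase s₀ hs₀ t ht u
  exact ⟨differentiableOn_relSector_of_members hc0.le hc1 hρb hdiff hread, norm_le_relSector_of_members hc0.le hc1 hρb hbd hread,
    norm_sub_le_sq_relSector_of_members hc0 hc1 hρb hcen hread, eq_on_window_of_members hc0 hread⟩

/-! ## §4 The two-step centre: centred (2.15) about a `b`-dependent reference + the reference's approach to a coupling-blind value -/

/-- **THE TWO-STEP CENTRE.**  The producer's centred engine (dag-n10-c g6 `B13Term214Centred` ∕ `B13Bound226Centred`, lens T21) bounds each member against the REFERENCE member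
with the potential frozen to its background value — a `b`-DEPENDENT reference `ctr t b` (the characteristic functions of (2.3) still carry the coupling): `‖m t b − ctr t b‖ ≤ M₁·t²·W`;
the consumer's centre `V` has NO coupling argument (lens T13′: the N22 letter compares two REAL histories through one vertex).  If the reference itself approaches a coupling-blind
value at second order, `‖ctr t b − V‖ ≤ M₂·t²·W` (the large-field tail of the frozen term; for a term with a σ-operation `V = 0` by `B13SigmaFreeKernels.term214_sigmaFree` +
`B13Term214Centred.integrand214_const_of_mgf`, lens T22), then the members are centred about `V` with `M₁ + M₂` — the hypothesis `hcen` of §2∕§3.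
[cite: Balaban1987RG1, (2.12)-(2.13) p.268; Balaban1988RG2Cluster, (2.3) p.12, (2.14)-(2.15) p.15 and (2.22) p.16] -/
theorem centred_of_twoStep {γ ρb : ℝ} {m ctr : ℝ → ℂ → ℂ} {V : ℂ} {M₁ M₂ W : ℝ}
    (h₁ : ∀ t ∈ Ioc (0 : ℝ) γ, ∀ b ∈ ball (1 : ℂ) ρb, ‖m t b - ctr t b‖ ≤ M₁ * t ^ 2 * W)
    (h₂ : ∀ t ∈ Ioc (0 : ℝ) γ, ∀ b ∈ ball (1 : ℂ) ρb, ‖ctr t b - V‖ ≤ M₂ * t ^ 2 * W) :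
    ∀ t ∈ Ioc (0 : ℝ) γ, ∀ b ∈ ball (1 : ℂ) ρb, ‖m t b - V‖ ≤ (M₁ + M₂) * t ^ 2 * W := fun t ht b hb =>
  calc ‖m t b - V‖ ≤ ‖m t b - ctr t b‖ + ‖ctr t b - V‖ := norm_sub_le_norm_sub_add_norm_sub _ _ _
    _ ≤ M₁ * t ^ 2 * W + M₂ * t ^ 2 * W := add_le_add (h₁ t ht b hb) (h₂ t ht b hb)
    _ = (M₁ + M₂) * t ^ 2 * W := by ring

end YMDAG.N22.W1

end
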